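import Summits.CriticalPhenomena.PercolationContinuityZ3.Theorems.Transplant.SkelFrmFromBParamsFaceOriginsXLA
import Summits.CriticalPhenomena.PercolationContinuityZ3.Theorems.Transplant.SkelFrmBParamsFaceOriginsXLA
import Summits.CriticalPhenomena.PercolationContinuityZ3.Theorems.Transplant.SkelFrmFromBParamsFaceFloorsL2XA
import Summits.CriticalPhenomena.PercolationContinuityZ3.Theorems.Transplant.SkelFrmBParamsFaceFloorsL2XA
import Summits.CriticalPhenomena.PercolationContinuityZ3.Theorems.Transplant.SkelFrmFromBParamsFaceFloorsFitXA
import Summits.CriticalPhenomena.PercolationContinuityZ3.Theorems.Transplant.SkelFrmBParamsFaceFloorsFitXA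
import Summits.CriticalPhenomena.PercolationContinuityZ3.Theorems.Transplant.SkelFrmFromBParamsFaceFloorsClrXA
import Summits.CriticalPhenomena.PercolationContinuityZ3.Theorems.Transplant.SkelFrmBParamsFaceFloorsClrXA
import Summits.CriticalPhenomena.PercolationContinuityZ3.Theorems.Transplant.SkelFrmFromBParamsFaceFloorsZXA
import Summits.CriticalPhenomena.PercolationContinuityZ3.Theorems.Transplant.SkelFrmBParamsFaceFloorsZXA
import Summits.CriticalPhenomena.PercolationContinuityZ3.Theorems.Transplant.SkelFrmFromBParamsFaceFloorsPiXA
import Summits.CriticalPhenomena.PercolationContinuityZ3.Theorems.Transplant.SkelFrmBParamsFaceFloorsPiXA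
import Summits.CriticalPhenomena.PercolationContinuityZ3.Theorems.Transplant.SkelFrmFromBParamsFaceFloorsTXAR0
import Summits.CriticalPhenomena.PercolationContinuityZ3.Theorems.Transplant.SkelFrmBParamsFaceFloorsTXAR0
import Summits.CriticalPhenomena.PercolationContinuityZ3.Theorems.Transplant.SkelFrmFromBParamsFaceFloorsAXAR0
import Summits.CriticalPhenomena.PercolationContinuityZ3.Theorems.Transplant.SkelFrmBParamsFaceFloorsAXAR0
import Summits.CriticalPhenomena.PercolationContinuityZ3.Theorems.Transplant.SkelFrmFromBParamsFaceFloorsAXA2R0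
import Summits.CriticalPhenomena.PercolationContinuityZ3.Theorems.Transplant.SkelFrmBParamsFaceFloorsAXA2R0
import Summits.CriticalPhenomena.PercolationContinuityZ3.Theorems.Transplant.SkelFrmFromBParamsFaceFloorsTYA
import Summits.CriticalPhenomena.PercolationContinuityZ3.Theorems.Transplant.SkelFrmBParamsFaceFloorsTYA
import Summits.CriticalPhenomena.PercolationContinuityZ3.Theorems.Transplant.SkelFrmFromBParamsFaceFloorsAYA
import Summits.CriticalPhenomena.PercolationContinuityZ3.Theorems.Transplant.SkelFrmBParamsFaceFloorsAYA
import Summits.CriticalPhenomena.PercolationContinuityZ3.Theorems.Transplant.SkelPhiFaceNumsXP2T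
import Summits.CriticalPhenomena.PercolationContinuityZ3.Theorems.Transplant.SkelFrmFromBParamsFaceCountsShiftA
import Summits.CriticalPhenomena.PercolationContinuityZ3.Theorems.Transplant.SkelFrmBParamsFaceCountsShiftA
import Summits.CriticalPhenomena.PercolationContinuityZ3.Theorems.Transplant.SkelFrmFromBChoiceWindow
import Summits.CriticalPhenomena.PercolationContinuityZ3.Theorems.Transplant.SkelFrmBChoiceWindow
import Summits.CriticalPhenomena.PercolationContinuityZ3.Theorems.Transplant.PlanarSkeletonFrmFromDefs
import Summits.CriticalPhenomena.PercolationContinuityZ3.Theorems.Transplant.PlanarSkeletonFrmDefs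
import Summits.CriticalPhenomena.PercolationContinuityZ3.Theorems.Transplant.SkelPhiStepIDataNS
import HarnessLib
import Summits.CriticalPhenomena.PercolationContinuityZ3.Theorems.Transplant.SkelFrmBParamsFaceFloorsX2SA
/-!
# U-WAVE PORT (RULING D-U, lead g21 2026-08-26; WAVE-U-MANIFEST v3.1 row «SkelFrmBParamsFaceFloorsX2SA» ↦ «SkelFrmFromBParamsFaceFloorsX2SA») of the tree module
# `Transplant/SkelFrmBParamsFaceFloorsX2SA` onto the carrier `PlanarSkeletonFrmFrom` (frames only, cylinders connected from width `ℓ₀` on)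

ORIGINAL TITLE: (F) VALUE LAYER, N2 twin (hp-8 g42, 2026-08-23; F-DISCHARGE-MAP-N2 G18 — THE x-FACE ASSEMBLY `Skelφ.FloorsX2T` AT THE (ζ′) TUPLE, bridge case SAME — the only

builds on p205010 (kernel theorem, internal audit signed; external expert review pending) — nothing in this file uses p205010; NOTHING is claimed about the
OPEN node U `SamePDropOfSkeletonFrmFrom₁` (nor U_s / the end state).  Lane `prim-bschramm`, seat `prim-bschramm-stmt` gen 26 (port pen, RULING M-11 family P-stmt; tool = p3-g26's port_u.py of record, registry-driven inputs); helper file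
(`--supports stmt-CriticalPhenomena-4575 --as helper`).  PORT RULES r1–r4 of RULING D-U: declaration order and proof texts are those of the original,
byte-identical except (i) the carrier token `PlanarSkeletonFrm ↦ PlanarSkeletonFrmFrom` (binders, `namespace`/`end` lines, qualified names of twinned
declarations), (ii) carrier-FREE declarations of the original (φ-level `Skelφ…` blocks and namespace-only arithmetic residents) are NOT re-declared —
this file imports the original and `export`s the twin-free residents (POLICY T / treatment (m1)); residents whose statement mentions a twinned
constant are copied, (iii) every carrier-binding declaration keeps its explicit binder `(Φ : PlanarSkeletonFrmFrom G)` in its own signature (r2).  Docstrings and citations are the original's.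
-/

noncomputable section

open scoped Classical

namespace Summit.CriticalPhenomena.PercolationContinuityZ3.Theorems.Transplant

namespace PlanarSkeletonFrmFrom

namespace NegB

open Literature.Probability.Percolation Literature.Probability.LatticeModels SimpleGraph KNCells KNLevels
open Literature.Probability.Percolation.KozmaNitzan.Cells (oth sgOf sgOf_sign stepVec_apply_fst)
open SkelConc (Consts)
open Skelφ (shearUnit shearUnit_pos)
open Skelφ.StepI (DataN)
open ChainPlanar (BridgePrm)
open TwoAxis.Para (modulus)
open Neg

namespace KS

/-- **The tangential positions of the x-face's y′-run stay inside the transverse habitat**: for `k ≤ N3X`, `F′ + σT·u₁·k` lies between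
`−(5r₁ − 7 − |z₁ − cen₁|) + 5u₁ + 1` and `5r₁ − 7 − |z₁ − cen₁| − 5u₁ − 1` (`|F1cA yL| ≤ 6u₁`, `|F′ − F1cA yL| ≤ 2`, `2kE + 8u₁ + 8 ≤ 5r₁`, `r₁ = 40Kq·u₁`). [folklore] -/
theorem tanX_pos_XA (κ : Consts) {V : Type} [DecidableEq V] [Countable V] {G : SimpleGraph V} [G.LocallyFinite] (Φ : PlanarSkeletonFrmFrom G) (t : V) (p : unitInterval) (D : Skelφ.StepI.DataNS V) (g f : ℕ) (P : PCells2T) (yL x : Site 2) (du : MDir) (hd : du.1 = 0) (z : Site 2) {kE : ℤ} (hz : |z 1 - P.cenS x 1| ≤ kE)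
    (hkE2 : 2 * kE + 8 * u₁A κ Φ t p D g f + 8 + 2 * (P.c 0 : ℤ) ≤ 5 * (P.r 1 : ℤ))
    (hr1 : (P.r 1 : ℤ) = 40 * (Neg.Kq κ : ℤ) * u₁A κ Φ t p D g f) (hu : 1 ≤ u₁A κ Φ t p D g f) (hq1 : (1 : ℤ) ≤ Neg.Kq κ)
    (he1 : |F1cA κ Φ t p D g f yL| ≤ 6 * u₁A κ Φ t p D g f) (F' : ℤ) (hF' : |F' - F1cA κ Φ t p D g f yL| ≤ 2) :
    ∀ k ≤ N3X κ Φ t p D g f P yL x du z,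
      -(5 * (P.r 1 : ℤ) - 4 - 3 - P.c 0 - |z 1 - P.cenS x 1|) + 5 * u₁A κ Φ t p D g f + 1 ≤
          F' + σTX κ Φ t p D g f P yL x du z * u₁A κ Φ t p D g f * (k : ℤ) ∧
        F' + σTX κ Φ t p D g f P yL x du z * u₁A κ Φ t p D g f * (k : ℤ) + 5 * u₁A κ Φ t p D g f + 1 ≤
          5 * (P.r 1 : ℤ) - 4 - 3 - P.c 0 - |z 1 - P.cenS x 1| := by
  intro k hk
  obtain ⟨-, hN1, -⟩ := N3X_spec κ Φ t p D g f P yL x du z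
  have hcase : (σTX κ Φ t p D g f P yL x du z = 1 ∧ F1cA κ Φ t p D g f yL ≤ T1X P x du z) ∨
      (σTX κ Φ t p D g f P yL x du z = -1 ∧ T1X P x du z < F1cA κ Φ t p D g f yL) := by
    unfold σTX; split_ifs with h
    · exact Or.inl ⟨rfl, h⟩
    · exact Or.inr ⟨rfl, lt_of_not_ge h⟩
  have hk' : (k : ℤ) ≤ (N3X κ Φ t p D g f P yL x du z : ℤ) := by exact_mod_cast hk
  -- N2 (staggered): the target is the NEIGHBOUR's centre, `T1X = (cenS x 1 − z 1) + σ·c 0` (`cenS_step_one`), so `|T1X| ≤ |z 1 − cenS x 1| + c 0`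
  have hc0 : (0 : ℤ) ≤ P.c 0 := P.c_nonneg 0
  have hσ1 : |sgOf du| = 1 := by rcases sgOf_sign du with h | h <;> simp [h]
  have hTle' : |T1X P x du z| ≤ |z 1 - P.cenS x 1| + P.c 0 := by
    have e : T1X P x du z = -(z 1 - P.cenS x 1) + sgOf du * P.c 0 := by unfold T1X; rw [cenS_step_one P x du hd]; ring
    rw [e]
    calc |-(z 1 - P.cenS x 1) + sgOf du * P.c 0| ≤ |-(z 1 - P.cenS x 1)| + |sgOf du * P.c 0| := abs_add_le _ _
      _ = |z 1 - P.cenS x 1| + P.c 0 := by rw [abs_neg, abs_mul, hσ1, one_mul, abs_of_nonneg hc0]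
  have ha0 : 0 ≤ |z 1 - P.cenS x 1| := abs_nonneg _
  obtain ⟨e1, e2⟩ := abs_le.1 he1
  obtain ⟨f1, f2⟩ := abs_le.1 hF'
  generalize σTX κ Φ t p D g f P yL x du z = σ' at hcase ⊢
  generalize |z 1 - P.cenS x 1| = Az at hz hTle' ha0 ⊢
  generalize (P.c 0 : ℤ) = cc at hkE2 hc0 hTle' ⊢
  generalize T1X P x du z = T at hN1 hTle' hcase ⊢
  generalize F1cA κ Φ t p D g f yL = F₀ at hN1 e1 e2 f1 f2 hcase ⊢
  generalize u₁A κ Φ t p D g f = u at hkE2 hr1 hu hN1 e1 e2 ⊢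
  generalize (N3X κ Φ t p D g f P yL x du z : ℤ) = N at hN1 hk'
  have hku : u * (k : ℤ) ≤ u * N := mul_le_mul_of_nonneg_left hk' (by linarith)
  have hk0 : 0 ≤ u * (k : ℤ) := mul_nonneg (by linarith) (by positivity)
  have hTabs : -|T| ≤ T ∧ T ≤ |T| := ⟨neg_abs_le T, le_abs_self T⟩
  have hT0 : 0 ≤ |T| := abs_nonneg T
  rcases hcase with ⟨rfl, hFT⟩ | ⟨rfl, hFT⟩
  · rw [abs_of_nonneg (by linarith)] at hN1
    constructor <;> nlinarith [hTabs.1, hTabs.2, hTle']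
  · rw [abs_of_neg (by linarith)] at hN1
    constructor <;> nlinarith [hTabs.1, hTabs.2, hTle']

export PlanarSkeletonFrm.NegB.KS (abs_add_signShift)

set_option maxHeartbeats 4000000 in
/-- **M3, x-face: `Skelφ.FloorsX2` at the (ζ′) tuple, bridge case same (`o_b = o_L`, `KS.BFs`)** — all 27 fields at the landing origin of the case (see the module
docstring for the parameter ledger and the remaining glue-level hypotheses). [cite: KozmaNitzan2024, §4 Lemma 11–12 (pp. 21–25)] -/
theorem floorsX2_XFs (κ : Consts) {V : Type} [DecidableEq V] [Countable V] {G : SimpleGraph V} [G.LocallyFinite] (Φ : PlanarSkeletonFrmFrom G) (t : V) (p : unitInterval) (D : Skelφ.StepI.DataNS V) (c : ℕ) (mk : ℕ) (gx : Neg.FSlot) (fx : Neg.FSlot) (P : PCells2T) (hP : P.toPCells2 = fcellsA κ Φ t p D (gT mk gx κ Φ t p D) (fT mk fx κ Φ t p D))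
    (hN : EqNumL κ Φ t p D (gT mk gx κ Φ t p D) (fT mk fx κ Φ t p D))
    (hκ : (hL κ Φ t p D (gT mk gx κ Φ t p D) (fT mk fx κ Φ t p D)).natAbs ≤ 10 * nL κ Φ t p D (gT mk gx κ Φ t p D) (fT mk fx κ Φ t p D))
    (hnA : 2000 * Neg.Kq κ * (KS0.R'0 κ Φ t p D mk + 2) ≤ nL κ Φ t p D (gT mk gx κ Φ t p D) (fT mk fx κ Φ t p D))
    (hℓA : 22000 * Neg.Kq κ * (KS0.R'0 κ Φ t p D mk + 2) ≤ ℓL κ Φ t p D (gT mk gx κ Φ t p D) (fT mk fx κ Φ t p D))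
    (hnA24 : 2400 * Neg.Kq κ * (KS0.R'0 κ Φ t p D mk + 2) ≤ nL κ Φ t p D (gT mk gx κ Φ t p D) (fT mk fx κ Φ t p D))
    (hS : 16 * SF κ Φ t p D c mk ≤ ML κ Φ t p D (gT mk gx κ Φ t p D)) (hR0 : 22000 * (KS0.R'0 κ Φ t p D mk + 2) ≤ ML κ Φ t p D (gT mk gx κ Φ t p D))
    (hu2 : 2 ≤ u₁A κ Φ t p D (gT mk gx κ Φ t p D) (fT mk fx κ Φ t p D))
    (hs0 : 6 * (KS0.R'0 κ Φ t p D mk : ℤ) + 11 ≤ u₀A κ Φ t p D (gT mk gx κ Φ t p D) (fT mk fx κ Φ t p D))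
    (hkF0 : kF₀A κ Φ t p D c mk (gT mk gx κ Φ t p D) (fT mk fx κ Φ t p D) ≤ 8 * u₀A κ Φ t p D (gT mk gx κ Φ t p D) (fT mk fx κ Φ t p D) + 1)
    (hkF1 : kF₁A κ Φ t p D c mk (gT mk gx κ Φ t p D) (fT mk fx κ Φ t p D) ≤ 8 * u₁A κ Φ t p D (gT mk gx κ Φ t p D) (fT mk fx κ Φ t p D) + 1)
    (x : Site 2) (du : MDir) (hd : du.1 = 0) (j : ℕ) (hj : j < P.K) (z : Site 2) {E : ℕ} {kE : ℤ}
    (hlev1 : (P.faceL 0 j : ℤ) - E ≤ P.lev du x z)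
    (hlev2 : P.lev du x z ≤ P.faceL 0 j + E)
    (hz : |z 1 - P.cenS x 1| ≤ kE)
    (hEu : (E : ℤ) ≤ u₀A κ Φ t p D (gT mk gx κ Φ t p D) (fT mk fx κ Φ t p D))
    (hkE : kE ≤ 5 * (P.r 1 : ℤ))
    (hkE2 : 2 * kE + 8 * u₁A κ Φ t p D (gT mk gx κ Φ t p D) (fT mk fx κ Φ t p D) + 8 + 2 * (P.c 0 : ℤ) ≤ 5 * (P.r 1 : ℤ))
    (hE2 : (E : ℤ) ≤ 2 * (KS0.R'0 κ Φ t p D mk : ℤ))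
    (r : ℕ) (hr : πBudX κ Φ t p D c mk (gT mk gx κ Φ t p D) (fT mk fx κ Φ t p D) ≤ r) :
    Skelφ.FloorsX2T (prFA κ Φ t p D (gT mk gx κ Φ t p D) (fT mk fx κ Φ t p D)) (nL κ Φ t p D (gT mk gx κ Φ t p D) (fT mk fx κ Φ t p D)) (u₀A κ Φ t p D (gT mk gx κ Φ t p D) (fT mk fx κ Φ t p D)) (u₁A κ Φ t p D (gT mk gx κ Φ t p D) (fT mk fx κ Φ t p D))
      (modulus (nL κ Φ t p D (gT mk gx κ Φ t p D) (fT mk fx κ Φ t p D)) (hL κ Φ t p D (gT mk gx κ Φ t p D) (fT mk fx κ Φ t p D)) (vL κ Φ t p D (gT mk gx κ Φ t p D) (fT mk fx κ Φ t p D)) (vβL κ Φ t p D (gT mk gx κ Φ t p D) (fT mk fx κ Φ t p D))) (nL κ Φ t p D (gT mk gx κ Φ t p D) (fT mk fx κ Φ t p D) : ℤ) (ℓL κ Φ t p D (gT mk gx κ Φ t p D) (fT mk fx κ Φ t p D))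
      P (NegB.BSlot.small κ Φ t p D (gT mk gx κ Φ t p D) (fT mk fx κ Φ t p D)) x du j 3 r (Mu D) z
      (fun i => if i = 0 then kF₀A κ Φ t p D c mk (gT mk gx κ Φ t p D) (fT mk fx κ Φ t p D) else kF₁A κ Φ t p D c mk (gT mk gx κ Φ t p D) (fT mk fx κ Φ t p D))
      (BFs κ Φ t p D c mk (gT mk gx κ Φ t p D) (fT mk fx κ Φ t p D) (sgOf du)) (KS0.R'0 κ Φ t p D mk) (qBXFs κ Φ t p D mk) (KS0.R'0 κ Φ t p D mk) (qB3XA κ Φ t p D (gT mk gx κ Φ t p D) (fT mk fx κ Φ t p D) (KS0.R'0 κ Φ t p D mk))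
      (yLXFs κ Φ t p D c mk (gT mk gx κ Φ t p D) (fT mk fx κ Φ t p D) (sgOf du)) (NrX κ Φ t p D (gT mk gx κ Φ t p D) (fT mk fx κ Φ t p D) P (yLXFs κ Φ t p D c mk (gT mk gx κ Φ t p D) (fT mk fx κ Φ t p D) (sgOf du)) (σTX κ Φ t p D (gT mk gx κ Φ t p D) (fT mk fx κ Φ t p D) P (yLXFs κ Φ t p D c mk (gT mk gx κ Φ t p D) (fT mk fx κ Φ t p D) (sgOf du)) x du z) x du z) (N3X κ Φ t p D (gT mk gx κ Φ t p D) (fT mk fx κ Φ t p D) P (yLXFs κ Φ t p D c mk (gT mk gx κ Φ t p D) (fT mk fx κ Φ t p D) (sgOf du)) x du z) (σTX κ Φ t p D (gT mk gx κ Φ t p D) (fT mk fx κ Φ t p D) P (yLXFs κ Φ t p D c mk (gT mk gx κ Φ t p D) (fT mk fx κ Φ t p D) (sgOf du)) x du z) := by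
  have hσ : sgOf du = 1 ∨ sgOf du = -1 := sgOf_sign du
  obtain ⟨hΛ₀, hΛ₁⟩ := Λ_yLXFs κ Φ t p D c mk (fT mk fx κ Φ t p D) gx hN hκ hS hR0 hσ
  have hσT : (σTX κ Φ t p D (gT mk gx κ Φ t p D) (fT mk fx κ Φ t p D) P (yLXFs κ Φ t p D c mk (gT mk gx κ Φ t p D) (fT mk fx κ Φ t p D) (sgOf du)) x du z) = 1 ∨ (σTX κ Φ t p D (gT mk gx κ Φ t p D) (fT mk fx κ Φ t p D) P (yLXFs κ Φ t p D c mk (gT mk gx κ Φ t p D) (fT mk fx κ Φ t p D) (sgOf du)) x du z) = -1 := by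
    unfold σTX; split_ifs <;> simp
  have he0 := he0_of_Λ₀ κ Φ t p D (gT mk gx κ Φ t p D) (fT mk fx κ Φ t p D) hN (yLXFs κ Φ t p D c mk (gT mk gx κ Φ t p D) (fT mk fx κ Φ t p D) (sgOf du)) hΛ₀ hσT
  have he1 := he1_of_Λ₁ κ Φ t p D (gT mk gx κ Φ t p D) (fT mk fx κ Φ t p D) hN (yLXFs κ Φ t p D c mk (gT mk gx κ Φ t p D) (fT mk fx κ Φ t p D) (sgOf du)) hΛ₁
  have hq4 := four_qBXFs_le κ Φ t p D mk gx fx hnA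
  have hyL := hyL_XFs κ Φ t p D c mk (gT mk gx κ Φ t p D) (fT mk fx κ Φ t p D) hσ
  have hyl := yLXFs_l1 κ Φ t p D c mk gx fx hσ
  have hu0 : 1 ≤ u₀A κ Φ t p D (gT mk gx κ Φ t p D) (fT mk fx κ Φ t p D) := (units_eqA κ Φ t p D (gT mk gx κ Φ t p D) (fT mk fx κ Φ t p D)).2.2.2.2.1
  have hu1 : 1 ≤ u₁A κ Φ t p D (gT mk gx κ Φ t p D) (fT mk fx κ Φ t p D) := (units_eqA κ Φ t p D (gT mk gx κ Φ t p D) (fT mk fx κ Φ t p D)).2.2.2.2.2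
  obtain ⟨hrP, hsP, hKP⟩ := cells_of_hP κ Φ t p D (gT mk gx κ Φ t p D) (fT mk fx κ Φ t p D) P hP
  have hr0 : (P.r 0 : ℤ) = 40 * (Neg.Kq κ : ℤ) * u₀A κ Φ t p D (gT mk gx κ Φ t p D) (fT mk fx κ Φ t p D) := by rw [hrP 0]; exact (units_eqA κ Φ t p D (gT mk gx κ Φ t p D) (fT mk fx κ Φ t p D)).2.2.1
  have hr1 : (P.r 1 : ℤ) = 40 * (Neg.Kq κ : ℤ) * u₁A κ Φ t p D (gT mk gx κ Φ t p D) (fT mk fx κ Φ t p D) := by rw [hrP 1]; exact (units_eqA κ Φ t p D (gT mk gx κ Φ t p D) (fT mk fx κ Φ t p D)).2.2.2.1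
  have es0 : ((P.s 0 : ℕ) : ℤ) = u₀A κ Φ t p D (gT mk gx κ Φ t p D) (fT mk fx κ Φ t p D) := by rw [hsP 0]; rfl
  have hc0 : (0 : ℤ) ≤ P.c 0 := P.c_nonneg 0
  have hq1 : (1 : ℤ) ≤ Neg.Kq κ := by exact_mod_cast Neg.one_le_Kq κ
  have hR0' : (0 : ℤ) ≤ (KS0.R'0 κ Φ t p D mk : ℤ) := by positivity
  have ha0 : 0 ≤ kE := (abs_nonneg _).trans hz
  have hkE8 : kE + 8 * u₁A κ Φ t p D (gT mk gx κ Φ t p D) (fT mk fx κ Φ t p D) + 8 + P.c 0 ≤ 5 * (P.r 1 : ℤ) := by linarith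
  obtain ⟨hX, hNr⟩ := NrX_range κ Φ t p D (gT mk gx κ Φ t p D) (fT mk fx κ Φ t p D) P hP hN x du hd z hj hlev1 hlev2 (yLXFs κ Φ t p D c mk (gT mk gx κ Φ t p D) (fT mk fx κ Φ t p D) (sgOf du)) (σTX κ Φ t p D (gT mk gx κ Φ t p D) (fT mk fx κ Φ t p D) P (yLXFs κ Φ t p D c mk (gT mk gx κ Φ t p D) (fT mk fx κ Φ t p D) (sgOf du)) x du z) he0 (by linarith)
  have hN3 := N3X_range κ Φ t p D (gT mk gx κ Φ t p D) (fT mk fx κ Φ t p D) P hP (yLXFs κ Φ t p D c mk (gT mk gx κ Φ t p D) (fT mk fx κ Φ t p D) (sgOf du)) x du hd z hz hkE he1 (by linarith)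
  have hNr1000 : NrX κ Φ t p D (gT mk gx κ Φ t p D) (fT mk fx κ Φ t p D) P (yLXFs κ Φ t p D c mk (gT mk gx κ Φ t p D) (fT mk fx κ Φ t p D) (sgOf du)) (σTX κ Φ t p D (gT mk gx κ Φ t p D) (fT mk fx κ Φ t p D) P (yLXFs κ Φ t p D c mk (gT mk gx κ Φ t p D) (fT mk fx κ Φ t p D) (sgOf du)) x du z) x du z + 1 ≤ 1000 * Neg.Kq κ := by have := Neg.one_le_Kq κ; omega
  have hkN : ∀ k ≤ NrX κ Φ t p D (gT mk gx κ Φ t p D) (fT mk fx κ Φ t p D) P (yLXFs κ Φ t p D c mk (gT mk gx κ Φ t p D) (fT mk fx κ Φ t p D) (sgOf du)) (σTX κ Φ t p D (gT mk gx κ Φ t p D) (fT mk fx κ Φ t p D) P (yLXFs κ Φ t p D c mk (gT mk gx κ Φ t p D) (fT mk fx κ Φ t p D) (sgOf du)) x du z) x du z, k + 1 ≤ 1000 * Neg.Kq κ := fun k hk => by omega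
  have hk3 : ∀ k ≤ N3X κ Φ t p D (gT mk gx κ Φ t p D) (fT mk fx κ Φ t p D) P (yLXFs κ Φ t p D c mk (gT mk gx κ Φ t p D) (fT mk fx κ Φ t p D) (sgOf du)) x du z, k + 1 ≤ 240 * Neg.Kq κ + 10 := fun k hk => by omega
  have hk3' : ∀ k ≤ N3X κ Φ t p D (gT mk gx κ Φ t p D) (fT mk fx κ Φ t p D) P (yLXFs κ Φ t p D c mk (gT mk gx κ Φ t p D) (fT mk fx κ Φ t p D) (sgOf du)) x du z, k + 1 ≤ 1000 * Neg.Kq κ := fun k hk => by have := Neg.one_le_Kq κ; omega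
  have hΛ₁3 : |Λ₁of κ Φ t p D (gT mk gx κ Φ t p D) (fT mk fx κ Φ t p D) (yLXFs κ Φ t p D c mk (gT mk gx κ Φ t p D) (fT mk fx κ Φ t p D) (sgOf du))| ≤ 3 * modulus (nL κ Φ t p D (gT mk gx κ Φ t p D) (fT mk fx κ Φ t p D)) (hL κ Φ t p D (gT mk gx κ Φ t p D) (fT mk fx κ Φ t p D)) (vL κ Φ t p D (gT mk gx κ Φ t p D) (fT mk fx κ Φ t p D)) (vβL κ Φ t p D (gT mk gx κ Φ t p D) (fT mk fx κ Φ t p D)) :=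
    hΛ₁.trans (by linarith [abs_nonneg (Λ₁of κ Φ t p D (gT mk gx κ Φ t p D) (fT mk fx κ Φ t p D) (yLXFs κ Φ t p D c mk (gT mk gx κ Φ t p D) (fT mk fx κ Φ t p D) (sgOf du)))])
  -- along: faceL, target, far end
  have hfl : P.faceL 0 j = 5 * (P.r 0 : ℤ) + 10 * u₀A κ Φ t p D (gT mk gx κ Φ t p D) (fT mk fx κ Φ t p D) * ((j : ℤ) + 1) - 1 := by
    show P.toPCells2.faceL 0 j = 5 * (P.toPCells2.r 0 : ℤ) + 10 * u₀A κ Φ t p D (gT mk gx κ Φ t p D) (fT mk fx κ Φ t p D) * ((j : ℤ) + 1) - 1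
    unfold PCells2.faceL
    have es : (P.toPCells2.s 0 : ℤ) = u₀A κ Φ t p D (gT mk gx κ Φ t p D) (fT mk fx κ Φ t p D) := by rw [hsP 0]; rfl
    rw [es]; push_cast; ring
  have hlev : 5 * (P.r 0 : ℤ) + 10 * u₀A κ Φ t p D (gT mk gx κ Φ t p D) (fT mk fx κ Φ t p D) * ((j : ℤ) + 1) - 1 - E ≤ P.lev du x z := by
    rw [← hfl]; exact hlev1
  have hjr : u₀A κ Φ t p D (gT mk gx κ Φ t p D) (fT mk fx κ Φ t p D) * ((j : ℤ) + 1) ≤ (P.r 0 : ℤ) := by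
    have hj' : ((j : ℤ) + 1) ≤ (P.K : ℤ) := by exact_mod_cast hj
    have hrK : (P.r 0 : ℤ) = (P.K : ℤ) * u₀A κ Φ t p D (gT mk gx κ Φ t p D) (fT mk fx κ Φ t p D) := by rw [hrP 0, hKP, PCells2.r_eq]; unfold u₀A; ring
    rw [hrK]; nlinarith
  -- the along rows at the ALIGNED cells (p1's AXAR0/AXA2R0/TXAR0 read `(fcellsA …).r`/`.cen`): transport `r` by `hrP`, the level bound verbatim
  have hlevA : 5 * ((fcellsA κ Φ t p D (gT mk gx κ Φ t p D) (fT mk fx κ Φ t p D)).r 0 : ℤ) + 10 * u₀A κ Φ t p D (gT mk gx κ Φ t p D) (fT mk fx κ Φ t p D) * ((j : ℤ) + 1) - 1 - E ≤ P.lev du x z := by rw [← hrP 0]; exact hlev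
  obtain ⟨hT1, -⟩ := NrX_spec κ Φ t p D (gT mk gx κ Φ t p D) (fT mk fx κ Φ t p D) P hN (yLXFs κ Φ t p D c mk (gT mk gx κ Φ t p D) (fT mk fx κ Φ t p D) (sgOf du)) (σTX κ Φ t p D (gT mk gx κ Φ t p D) (fT mk fx κ Φ t p D) P (yLXFs κ Φ t p D c mk (gT mk gx κ Φ t p D) (fT mk fx κ Φ t p D) (sgOf du)) x du z) x du z hX
  have hT0 := T0X_eq P x du hd z
  have hfar := hfar_of_NrX κ Φ t p D (gT mk gx κ Φ t p D) (fT mk fx κ Φ t p D) P hN (yLXFs κ Φ t p D c mk (gT mk gx κ Φ t p D) (fT mk fx κ Φ t p D) (sgOf du)) hσT x du hd z hX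
  obtain ⟨n1, n2⟩ := abs_le.1 hT1
  -- the shifted contact for p1's aligned-centre transverse rows (see `abs_add_signShift`)
  set Az : ℤ := z 1 - P.cenS x 1 with hAz
  let zsh : Site 2 := fun k => if k = 1 then (fcellsA κ Φ t p D (gT mk gx κ Φ t p D) (fT mk fx κ Φ t p D)).cen x 1 + (Az + (if 0 ≤ Az then (P.c 0 : ℤ) else -(P.c 0 : ℤ))) else z k
  have hzsh : |zsh 1 - (fcellsA κ Φ t p D (gT mk gx κ Φ t p D) (fT mk fx κ Φ t p D)).cen x 1| = |z 1 - P.cenS x 1| + P.c 0 := by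
    show |((fcellsA κ Φ t p D (gT mk gx κ Φ t p D) (fT mk fx κ Φ t p D)).cen x 1 + (Az + (if 0 ≤ Az then (P.c 0 : ℤ) else -(P.c 0 : ℤ)))) - (fcellsA κ Φ t p D (gT mk gx κ Φ t p D) (fT mk fx κ Φ t p D)).cen x 1| = |Az| + P.c 0
    rw [add_sub_cancel_left]; exact abs_add_signShift Az (P.c 0) hc0
  have hfw1 : |zsh 1 - (fcellsA κ Φ t p D (gT mk gx κ Φ t p D) (fT mk fx κ Φ t p D)).cen x 1| + 8 * u₁A κ Φ t p D (gT mk gx κ Φ t p D) (fT mk fx κ Φ t p D) + 8 ≤ 5 * (((fcellsA κ Φ t p D (gT mk gx κ Φ t p D) (fT mk fx κ Φ t p D)).r 1 : ℕ) : ℤ) := by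
    rw [hzsh, ← hrP 1]; linarith
  have eroom : (5 * (P.r 1 : ℤ) - 4 - 3 - P.c 0 - |z 1 - P.cenS x 1|) = 5 * (((fcellsA κ Φ t p D (gT mk gx κ Φ t p D) (fT mk fx κ Φ t p D)).r 1 : ℕ) : ℤ) - 4 - 3 - |zsh 1 - (fcellsA κ Φ t p D (gT mk gx κ Φ t p D) (fT mk fx κ Φ t p D)).cen x 1| := by
    rw [hzsh, hrP 1]; ring
  have hF' := F1cA_yTX0_sub_abs_le κ Φ t p D (gT mk gx κ Φ t p D) (fT mk fx κ Φ t p D) hN (yLXFs κ Φ t p D c mk (gT mk gx κ Φ t p D) (fT mk fx κ Φ t p D) (sgOf du)) (σTX κ Φ t p D (gT mk gx κ Φ t p D) (fT mk fx κ Φ t p D) P (yLXFs κ Φ t p D c mk (gT mk gx κ Φ t p D) (fT mk fx κ Φ t p D) (sgOf du)) x du z)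
  have htan := tanX_pos_XA κ Φ t p D (gT mk gx κ Φ t p D) (fT mk fx κ Φ t p D) P (yLXFs κ Φ t p D c mk (gT mk gx κ Φ t p D) (fT mk fx κ Φ t p D) (sgOf du)) x du hd z hz hkE2 hr1 hu1 hq1 he1 _ hF'
  have eF1 := F1cA_crossOffX κ Φ t p D (gT mk gx κ Φ t p D) (fT mk fx κ Φ t p D) (yLXFs κ Φ t p D c mk (gT mk gx κ Φ t p D) (fT mk fx κ Φ t p D) (sgOf du)) (sgOf du) (σTX κ Φ t p D (gT mk gx κ Φ t p D) (fT mk fx κ Φ t p D) P (yLXFs κ Φ t p D c mk (gT mk gx κ Φ t p D) (fT mk fx κ Φ t p D) (sgOf du)) x du z) (NrX κ Φ t p D (gT mk gx κ Φ t p D) (fT mk fx κ Φ t p D) P (yLXFs κ Φ t p D c mk (gT mk gx κ Φ t p D) (fT mk fx κ Φ t p D) (sgOf du)) (σTX κ Φ t p D (gT mk gx κ Φ t p D) (fT mk fx κ Φ t p D) P (yLXFs κ Φ t p D c mk (gT mk gx κ Φ t p D) (fT mk fx κ Φ t p D) (sgOf du)) x du z) x du z)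
  refine ⟨?_, ?_, hσT, ?_, ?_, ?_, ?_, ?_, ?_, ?_, ?_, ?_, ?_, ?_, ?_, ?_, ?_, ?_, ?_, ?_, ?_, ?_, ?_, ?_, ?_, ?_, ?_⟩
  · exact hfR_XA κ Φ t p D c mk (gT mk gx κ Φ t p D) (fT mk fx κ Φ t p D) P hP x du hd j hj z hlev1 hlev2 hz hEu hkF0 hkF1 hs0 hkE8
  · exact hZfar_XA κ Φ t p D c mk (gT mk gx κ Φ t p D) (fT mk fx κ Φ t p D) P hP x du hd j hj z hlev2 hEu hkF0
  · intro _ k hk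
    rw [hd, hrP 0, es0]
    exact FX1_XAR0 κ Φ t p D (gT mk gx κ Φ t p D) (fT mk fx κ Φ t p D) mk hN hκ hnA hℓA hs0 (yLXFs κ Φ t p D c mk (gT mk gx κ Φ t p D) (fT mk fx κ Φ t p D) (sgOf du)) hΛ₀ hq4 hE2 hlevA (hkN k hk)
  · intro hσ1 k hk
    rw [hd]
    have e : sgOf du * FcA κ Φ t p D (gT mk gx κ Φ t p D) (fT mk fx κ Φ t p D) (yLXFs κ Φ t p D c mk (gT mk gx κ Φ t p D) (fT mk fx κ Φ t p D) (sgOf du)) = FcA κ Φ t p D (gT mk gx κ Φ t p D) (fT mk fx κ Φ t p D) (yLXFs κ Φ t p D c mk (gT mk gx κ Φ t p D) (fT mk fx κ Φ t p D) (sgOf du)) := by rw [hσ1, one_mul]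
    have hrP0 := hrP 0
    have hfar' : FcA κ Φ t p D (gT mk gx κ Φ t p D) (fT mk fx κ Φ t p D) (yLXFs κ Φ t p D c mk (gT mk gx κ Φ t p D) (fT mk fx κ Φ t p D) (sgOf du)) + u₀A κ Φ t p D (gT mk gx κ Φ t p D) (fT mk fx κ Φ t p D) * (((NrX κ Φ t p D (gT mk gx κ Φ t p D) (fT mk fx κ Φ t p D) P (yLXFs κ Φ t p D c mk (gT mk gx κ Φ t p D) (fT mk fx κ Φ t p D) (sgOf du)) (σTX κ Φ t p D (gT mk gx κ Φ t p D) (fT mk fx κ Φ t p D) P (yLXFs κ Φ t p D c mk (gT mk gx κ Φ t p D) (fT mk fx κ Φ t p D) (sgOf du)) x du z) x du z) : ℤ) + 1) ≤ 20 * (((fcellsA κ Φ t p D (gT mk gx κ Φ t p D) (fT mk fx κ Φ t p D)).r 0 : ℕ) : ℤ) - P.lev du x z + 3 * u₀A κ Φ t p D (gT mk gx κ Φ t p D) (fT mk fx κ Φ t p D) := by linarith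
    rw [hrP 0]
    exact FX2_XA'R0 κ Φ t p D (gT mk gx κ Φ t p D) (fT mk fx κ Φ t p D) mk hN hκ hnA hℓA (yLXFs κ Φ t p D c mk (gT mk gx κ Φ t p D) (fT mk fx κ Φ t p D) (sgOf du)) hq4 hNr1000 hfar' hk
  · intro _ k hk
    rw [hd, hrP 0, es0]
    exact FX3_XAR0 κ Φ t p D (gT mk gx κ Φ t p D) (fT mk fx κ Φ t p D) mk hN hκ hnA hℓA hs0 (yLXFs κ Φ t p D c mk (gT mk gx κ Φ t p D) (fT mk fx κ Φ t p D) (sgOf du)) hΛ₀ hq4 hE2 hlevA (hkN k hk)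
  · intro hσ1 k hk
    rw [hd]
    have e : sgOf du * FcA κ Φ t p D (gT mk gx κ Φ t p D) (fT mk fx κ Φ t p D) (yLXFs κ Φ t p D c mk (gT mk gx κ Φ t p D) (fT mk fx κ Φ t p D) (sgOf du)) = -FcA κ Φ t p D (gT mk gx κ Φ t p D) (fT mk fx κ Φ t p D) (yLXFs κ Φ t p D c mk (gT mk gx κ Φ t p D) (fT mk fx κ Φ t p D) (sgOf du)) := by rw [hσ1, neg_one_mul]
    have hrP0 := hrP 0
    have hfar' : -FcA κ Φ t p D (gT mk gx κ Φ t p D) (fT mk fx κ Φ t p D) (yLXFs κ Φ t p D c mk (gT mk gx κ Φ t p D) (fT mk fx κ Φ t p D) (sgOf du)) + u₀A κ Φ t p D (gT mk gx κ Φ t p D) (fT mk fx κ Φ t p D) * (((NrX κ Φ t p D (gT mk gx κ Φ t p D) (fT mk fx κ Φ t p D) P (yLXFs κ Φ t p D c mk (gT mk gx κ Φ t p D) (fT mk fx κ Φ t p D) (sgOf du)) (σTX κ Φ t p D (gT mk gx κ Φ t p D) (fT mk fx κ Φ t p D) P (yLXFs κ Φ t p D c mk (gT mk gx κ Φ t p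 D) (fT mk fx κ Φ t p D) (sgOf du)) x du z) x du z) : ℤ) + 1) ≤ 20 * (((fcellsA κ Φ t p D (gT mk gx κ Φ t p D) (fT mk fx κ Φ t p D)).r 0 : ℕ) : ℤ) - P.lev du x z + 3 * u₀A κ Φ t p D (gT mk gx κ Φ t p D) (fT mk fx κ Φ t p D) := by linarith
    rw [hrP 0]
    exact FX4_XA'R0 κ Φ t p D (gT mk gx κ Φ t p D) (fT mk fx κ Φ t p D) mk hN hκ hnA hℓA (yLXFs κ Φ t p D c mk (gT mk gx κ Φ t p D) (fT mk fx κ Φ t p D) (sgOf du)) hq4 hNr1000 hfar' hk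
  · intro k hk
    rw [hd, show oth (0 : Fin 2) = 1 from rfl, eroom]
    exact FX5_XAR0 κ Φ t p D (gT mk gx κ Φ t p D) (fT mk fx κ Φ t p D) mk hN hκ hℓA (yLXFs κ Φ t p D c mk (gT mk gx κ Φ t p D) (fT mk fx κ Φ t p D) (sgOf du)) hΛ₁3 x zsh 1 hfw1 (hkN k hk)
  · intro k hk
    rw [hd, show oth (0 : Fin 2) = 1 from rfl, eroom]
    exact FX6_XAR0 κ Φ t p D (gT mk gx κ Φ t p D) (fT mk fx κ Φ t p D) mk hN hκ hℓA (yLXFs κ Φ t p D c mk (gT mk gx κ Φ t p D) (fT mk fx κ Φ t p D) (sgOf du)) hΛ₁3 x zsh 1 hfw1 (hkN k hk)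
  · intro hσ1 k hk
    rw [hd]
    rw [hσ1, one_mul] at hT0
    have hnear : 20 * (P.r 0 : ℤ) - P.lev du x z - 2 * u₀A κ Φ t p D (gT mk gx κ Φ t p D) (fT mk fx κ Φ t p D) ≤ FcA κ Φ t p D (gT mk gx κ Φ t p D) (fT mk fx κ Φ t p D) ((yLXFs κ Φ t p D c mk (gT mk gx κ Φ t p D) (fT mk fx κ Φ t p D) (sgOf du)) + Skelφ.crossOffX (nL κ Φ t p D (gT mk gx κ Φ t p D) (fT mk fx κ Φ t p D)) (hL κ Φ t p D (gT mk gx κ Φ t p D) (fT mk fx κ Φ t p D)) (vL κ Φ t p D (gT mk gx κ Φ t p D) (fT mk fx κ Φ t p D)) (sgOf du) (σTX κ Φ t p D (gT mk gx κ Φ t p D) (fT mk fx κ Φ t p D) P (yLXFs κ Φ t p D c mk (gT mk gx κ Φ t p D) (fT mk fx κ Φ t p D) (sgOf du)) x du z) (NrX κ Φ t p D (gT mk gx κ Φ t p D) (fT mk fx κ Φ t p D) P (yLXFs κ Φ t p D c mk (gT mk gx κ Φ t p D) (fT mk fx κ Φ t p D) (sgOf du)) (σTX κ Φ t p D (gT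 mk gx κ Φ t p D) (fT mk fx κ Φ t p D) P (yLXFs κ Φ t p D c mk (gT mk gx κ Φ t p D) (fT mk fx κ Φ t p D) (sgOf du)) x du z) x du z)) := by linarith
    try rw [es0]
    exact FY1_XA κ Φ t p D (gT mk gx κ Φ t p D) (fT mk fx κ Φ t p D) P hP mk hN hκ hnA24 hℓA ((yLXFs κ Φ t p D c mk (gT mk gx κ Φ t p D) (fT mk fx κ Φ t p D) (sgOf du)) + Skelφ.crossOffX (nL κ Φ t p D (gT mk gx κ Φ t p D) (fT mk fx κ Φ t p D)) (hL κ Φ t p D (gT mk gx κ Φ t p D) (fT mk fx κ Φ t p D)) (vL κ Φ t p D (gT mk gx κ Φ t p D) (fT mk fx κ Φ t p D)) (sgOf du) (σTX κ Φ t p D (gT mk gx κ Φ t p D) (fT mk fx κ Φ t p D) P (yLXFs κ Φ t p D c mk (gT mk gx κ Φ t p D) (fT mk fx κ Φ t p D) (sgOf du)) x du z) (NrX κ Φ t p D (gT mk gx κ Φ t p D) (fT mk fx κ Φ t p D) P (yLXFs κ Φ t p D c mk (gT mk gx κ Φ t p D) (fT mk fx κ Φ t p D) (sgOf du)) (σTX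 κ Φ t p D (gT mk gx κ Φ t p D) (fT mk fx κ Φ t p D) P (yLXFs κ Φ t p D c mk (gT mk gx κ Φ t p D) (fT mk fx κ Φ t p D) (sgOf du)) x du z) x du z)) (hk3 k hk) hjr hnear
  · intro hσ1 k hk
    rw [hd]
    rw [hσ1, one_mul] at hT0
    have hfarT : FcA κ Φ t p D (gT mk gx κ Φ t p D) (fT mk fx κ Φ t p D) ((yLXFs κ Φ t p D c mk (gT mk gx κ Φ t p D) (fT mk fx κ Φ t p D) (sgOf du)) + Skelφ.crossOffX (nL κ Φ t p D (gT mk gx κ Φ t p D) (fT mk fx κ Φ t p D)) (hL κ Φ t p D (gT mk gx κ Φ t p D) (fT mk fx κ Φ t p D)) (vL κ Φ t p D (gT mk gx κ Φ t p D) (fT mk fx κ Φ t p D)) (sgOf du) (σTX κ Φ t p D (gT mk gx κ Φ t p D) (fT mk fx κ Φ t p D) P (yLXFs κ Φ t p D c mk (gT mk gx κ Φ t p D) (fT mk fx κ Φ t p D) (sgOf du)) x du z) (NrX κ Φ t p D (gT mk gx κ Φ t p D) (fT mk fx κ Φ t p D) P (yLXFs κ Φ t p D c mk (gT mk gx κ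 Φ t p D) (fT mk fx κ Φ t p D) (sgOf du)) (σTX κ Φ t p D (gT mk gx κ Φ t p D) (fT mk fx κ Φ t p D) P (yLXFs κ Φ t p D c mk (gT mk gx κ Φ t p D) (fT mk fx κ Φ t p D) (sgOf du)) x du z) x du z)) ≤ 20 * (P.r 0 : ℤ) - P.lev du x z + 2 * u₀A κ Φ t p D (gT mk gx κ Φ t p D) (fT mk fx κ Φ t p D) := by linarith
    try rw [es0]
    exact FY2_XA κ Φ t p D (gT mk gx κ Φ t p D) (fT mk fx κ Φ t p D) P hP mk hN hκ hnA24 hℓA ((yLXFs κ Φ t p D c mk (gT mk gx κ Φ t p D) (fT mk fx κ Φ t p D) (sgOf du)) + Skelφ.crossOffX (nL κ Φ t p D (gT mk gx κ Φ t p D) (fT mk fx κ Φ t p D)) (hL κ Φ t p D (gT mk gx κ Φ t p D) (fT mk fx κ Φ t p D)) (vL κ Φ t p D (gT mk gx κ Φ t p D) (fT mk fx κ Φ t p D)) (sgOf du) (σTX κ Φ t p D (gT mk gx κ Φ t p D) (fT mk fx κ Φ t p D) P (yLXFs κ Φ t p D c mk (gT mk gx κ Φ t p D) (fT mk fx κ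 Φ t p D) (sgOf du)) x du z) (NrX κ Φ t p D (gT mk gx κ Φ t p D) (fT mk fx κ Φ t p D) P (yLXFs κ Φ t p D c mk (gT mk gx κ Φ t p D) (fT mk fx κ Φ t p D) (sgOf du)) (σTX κ Φ t p D (gT mk gx κ Φ t p D) (fT mk fx κ Φ t p D) P (yLXFs κ Φ t p D c mk (gT mk gx κ Φ t p D) (fT mk fx κ Φ t p D) (sgOf du)) x du z) x du z)) (hk3 k hk) hfarT
  · intro hσ1 k hk
    rw [hd]
    rw [hσ1, neg_one_mul] at hT0
    have hnear : 20 * (P.r 0 : ℤ) - P.lev du x z - 2 * u₀A κ Φ t p D (gT mk gx κ Φ t p D) (fT mk fx κ Φ t p D) ≤ -FcA κ Φ t p D (gT mk gx κ Φ t p D) (fT mk fx κ Φ t p D) ((yLXFs κ Φ t p D c mk (gT mk gx κ Φ t p D) (fT mk fx κ Φ t p D) (sgOf du)) + Skelφ.crossOffX (nL κ Φ t p D (gT mk gx κ Φ t p D) (fT mk fx κ Φ t p D)) (hL κ Φ t p D (gT mk gx κ Φ t p D) (fT mk fx κ Φ t p D)) (vL κ Φ t p D (gT mk gx κ Φ t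 p D) (fT mk fx κ Φ t p D)) (sgOf du) (σTX κ Φ t p D (gT mk gx κ Φ t p D) (fT mk fx κ Φ t p D) P (yLXFs κ Φ t p D c mk (gT mk gx κ Φ t p D) (fT mk fx κ Φ t p D) (sgOf du)) x du z) (NrX κ Φ t p D (gT mk gx κ Φ t p D) (fT mk fx κ Φ t p D) P (yLXFs κ Φ t p D c mk (gT mk gx κ Φ t p D) (fT mk fx κ Φ t p D) (sgOf du)) (σTX κ Φ t p D (gT mk gx κ Φ t p D) (fT mk fx κ Φ t p D) P (yLXFs κ Φ t p D c mk (gT mk gx κ Φ t p D) (fT mk fx κ Φ t p D) (sgOf du)) x du z) x du z)) := by linarith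
    try rw [es0]
    exact FY3_XA κ Φ t p D (gT mk gx κ Φ t p D) (fT mk fx κ Φ t p D) P hP mk hN hκ hnA24 hℓA ((yLXFs κ Φ t p D c mk (gT mk gx κ Φ t p D) (fT mk fx κ Φ t p D) (sgOf du)) + Skelφ.crossOffX (nL κ Φ t p D (gT mk gx κ Φ t p D) (fT mk fx κ Φ t p D)) (hL κ Φ t p D (gT mk gx κ Φ t p D) (fT mk fx κ Φ t p D)) (vL κ Φ t p D (gT mk gx κ Φ t p D) (fT mk fx κ Φ t p D)) (sgOf du) (σTX κ Φ t p D (gT mk gx κ Φ t p D) (fT mk fx κ Φ t p D) P (yLXFs κ Φ t p D c mk (gT mk gx κ Φ t p D) (fT mk fx κ Φ t p D) (sgOf du)) x du z) (NrX κ Φ t p D (gT mk gx κ Φ t p D) (fT mk fx κ Φ t p D) P (yLXFs κ Φ t p D c mk (gT mk gx κ Φ t p D) (fT mk fx κ Φ t p D) (sgOf du)) (σTX κ Φ t p D (gT mk gx κ Φ t p D) (fT mk fx κ Φ t p D) P (yLXFs κ Φ t p D c mk (gT mk gx κ Φ t p D) (fT mk fx κ Φ t p D) (sgOf du)) x du z)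 x du z)) (hk3 k hk) hjr hnear
  · intro hσ1 k hk
    rw [hd]
    rw [hσ1, neg_one_mul] at hT0
    have hfarT : -FcA κ Φ t p D (gT mk gx κ Φ t p D) (fT mk fx κ Φ t p D) ((yLXFs κ Φ t p D c mk (gT mk gx κ Φ t p D) (fT mk fx κ Φ t p D) (sgOf du)) + Skelφ.crossOffX (nL κ Φ t p D (gT mk gx κ Φ t p D) (fT mk fx κ Φ t p D)) (hL κ Φ t p D (gT mk gx κ Φ t p D) (fT mk fx κ Φ t p D)) (vL κ Φ t p D (gT mk gx κ Φ t p D) (fT mk fx κ Φ t p D)) (sgOf du) (σTX κ Φ t p D (gT mk gx κ Φ t p D) (fT mk fx κ Φ t p D) P (yLXFs κ Φ t p D c mk (gT mk gx κ Φ t p D) (fT mk fx κ Φ t p D) (sgOf du)) x du z) (NrX κ Φ t p D (gT mk gx κ Φ t p D) (fT mk fx κ Φ t p D) P (yLXFs κ Φ t p D c mk (gT mk gx κ Φ t p D) (fT mk fx κ Φ t p D) (sgOf du)) (σTX κ Φ t p D (gT mk gx κ Φ t p D) (fT mk fx κ Φ t p D) P (yLXFs κ Φ t p D c mk (gT mk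 gx κ Φ t p D) (fT mk fx κ Φ t p D) (sgOf du)) x du z) x du z)) ≤ 20 * (P.r 0 : ℤ) - P.lev du x z + 2 * u₀A κ Φ t p D (gT mk gx κ Φ t p D) (fT mk fx κ Φ t p D) := by linarith
    try rw [es0]
    exact FY4_XA κ Φ t p D (gT mk gx κ Φ t p D) (fT mk fx κ Φ t p D) P hP mk hN hκ hnA24 hℓA ((yLXFs κ Φ t p D c mk (gT mk gx κ Φ t p D) (fT mk fx κ Φ t p D) (sgOf du)) + Skelφ.crossOffX (nL κ Φ t p D (gT mk gx κ Φ t p D) (fT mk fx κ Φ t p D)) (hL κ Φ t p D (gT mk gx κ Φ t p D) (fT mk fx κ Φ t p D)) (vL κ Φ t p D (gT mk gx κ Φ t p D) (fT mk fx κ Φ t p D)) (sgOf du) (σTX κ Φ t p D (gT mk gx κ Φ t p D) (fT mk fx κ Φ t p D) P (yLXFs κ Φ t p D c mk (gT mk gx κ Φ t p D) (fT mk fx κ Φ t p D) (sgOf du)) x du z) (NrX κ Φ t p D (gT mk gx κ Φ t p D) (fT mk fx κ Φ t p D) P (yLXFs κ Φ t p D c mk (gT mk gx κ Φ t p D) (fT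 mk fx κ Φ t p D) (sgOf du)) (σTX κ Φ t p D (gT mk gx κ Φ t p D) (fT mk fx κ Φ t p D) P (yLXFs κ Φ t p D c mk (gT mk gx κ Φ t p D) (fT mk fx κ Φ t p D) (sgOf du)) x du z) x du z)) (hk3 k hk) hfarT
  · intro k hk
    have h := (htan k hk).1
    rw [← eF1] at h
    rw [hd, show oth (0 : Fin 2) = 1 from rfl]
    exact FY5_XA κ Φ t p D (gT mk gx κ Φ t p D) (fT mk fx κ Φ t p D) P 0 mk hN hκ hℓA ((yLXFs κ Φ t p D c mk (gT mk gx κ Φ t p D) (fT mk fx κ Φ t p D) (sgOf du)) + Skelφ.crossOffX (nL κ Φ t p D (gT mk gx κ Φ t p D) (fT mk fx κ Φ t p D)) (hL κ Φ t p D (gT mk gx κ Φ t p D) (fT mk fx κ Φ t p D)) (vL κ Φ t p D (gT mk gx κ Φ t p D) (fT mk fx κ Φ t p D)) (sgOf du) (σTX κ Φ t p D (gT mk gx κ Φ t p D) (fT mk fx κ Φ t p D) P (yLXFs κ Φ t p D c mk (gT mk gx κ Φ t p D) (fT mk fx κ Φ t p D) (sgOf du)) x du z) (NrX κ Φ t p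 D (gT mk gx κ Φ t p D) (fT mk fx κ Φ t p D) P (yLXFs κ Φ t p D c mk (gT mk gx κ Φ t p D) (fT mk fx κ Φ t p D) (sgOf du)) (σTX κ Φ t p D (gT mk gx κ Φ t p D) (fT mk fx κ Φ t p D) P (yLXFs κ Φ t p D c mk (gT mk gx κ Φ t p D) (fT mk fx κ Φ t p D) (sgOf du)) x du z) x du z)) x z 1 hσT (hk3 k hk) h
  · intro k hk
    have h := (htan k hk).2
    rw [← eF1] at h
    rw [hd, show oth (0 : Fin 2) = 1 from rfl]
    exact FY6_XA κ Φ t p D (gT mk gx κ Φ t p D) (fT mk fx κ Φ t p D) P 0 mk hN hκ hℓA ((yLXFs κ Φ t p D c mk (gT mk gx κ Φ t p D) (fT mk fx κ Φ t p D) (sgOf du)) + Skelφ.crossOffX (nL κ Φ t p D (gT mk gx κ Φ t p D) (fT mk fx κ Φ t p D)) (hL κ Φ t p D (gT mk gx κ Φ t p D) (fT mk fx κ Φ t p D)) (vL κ Φ t p D (gT mk gx κ Φ t p D) (fT mk fx κ Φ t p D)) (sgOf du) (σTX κ Φ t p D (gT mk gx κ Φ t p D) (fT mk fx κ Φ t p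 D) P (yLXFs κ Φ t p D c mk (gT mk gx κ Φ t p D) (fT mk fx κ Φ t p D) (sgOf du)) x du z) (NrX κ Φ t p D (gT mk gx κ Φ t p D) (fT mk fx κ Φ t p D) P (yLXFs κ Φ t p D c mk (gT mk gx κ Φ t p D) (fT mk fx κ Φ t p D) (sgOf du)) (σTX κ Φ t p D (gT mk gx κ Φ t p D) (fT mk fx κ Φ t p D) P (yLXFs κ Φ t p D c mk (gT mk gx κ Φ t p D) (fT mk fx κ Φ t p D) (sgOf du)) x du z) x du z)) x z 1 hσT (hk3 k hk) h
  · exact FL1_XA κ Φ t p D (gT mk gx κ Φ t p D) (fT mk fx κ Φ t p D) mk P hP hN hκ hnA hℓA x du hd j hj z hlev1 hlev2 hz hEu hkE (yLXFs κ Φ t p D c mk (gT mk gx κ Φ t p D) (fT mk fx κ Φ t p D) (sgOf du)) he0 he1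
  · exact FL2_XA κ Φ t p D (gT mk gx κ Φ t p D) (fT mk fx κ Φ t p D) mk P hP hN hκ hnA hℓA x du hd j hj z hlev1 hlev2 hz hEu hkE (yLXFs κ Φ t p D c mk (gT mk gx κ Φ t p D) (fT mk fx κ Φ t p D) (sgOf du)) he0 he1
  · exact FL3_XA κ Φ t p D (gT mk gx κ Φ t p D) (fT mk fx κ Φ t p D) mk P hP hN hκ hu2 hnA hℓA x du hd z hz hkE (yLXFs κ Φ t p D c mk (gT mk gx κ Φ t p D) (fT mk fx κ Φ t p D) (sgOf du)) he1
  · exact FL4_XA κ Φ t p D (gT mk gx κ Φ t p D) (fT mk fx κ Φ t p D) mk P hP hN hκ hu2 hnA hℓA x du hd z hz hkE (yLXFs κ Φ t p D c mk (gT mk gx κ Φ t p D) (fT mk fx κ Φ t p D) (sgOf du)) he1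
  · exact hfit_XA κ Φ t p D mk (gT mk gx κ Φ t p D) (fT mk fx κ Φ t p D) P hP hN hnA x du hd j hj z hlev1 hlev2 hEu (yLXFs κ Φ t p D c mk (gT mk gx κ Φ t p D) (fT mk fx κ Φ t p D) (sgOf du)) he0 _ hq4
  · exact hq₃_XA κ Φ t p D mk (gT mk gx κ Φ t p D) (fT mk fx κ Φ t p D) P hP hN x du hd j hj z hlev1 hlev2 hEu (yLXFs κ Φ t p D c mk (gT mk gx κ Φ t p D) (fT mk fx κ Φ t p D) (sgOf du)) he0
  · exact hxaXF_s κ Φ t p D c mk (gT mk gx κ Φ t p D) (fT mk fx κ Φ t p D) hσ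
  · exact hxbXF_s κ Φ t p D c mk gx fx hN hκ hS hR0 hσ
  · exact hclr_XA κ Φ t p D mk (gT mk gx κ Φ t p D) (fT mk fx κ Φ t p D) P hnA x du z (yLXFs κ Φ t p D c mk (gT mk gx κ Φ t p D) (fT mk fx κ Φ t p D) (sgOf du)) _ hyL
  · exact hclr₃_XA κ Φ t p D mk (gT mk gx κ Φ t p D) (fT mk fx κ Φ t p D) P hP hN hκ hnA hℓA x du hd j hj z hlev1 hlev2 hEu (yLXFs κ Φ t p D c mk (gT mk gx κ Φ t p D) (fT mk fx κ Φ t p D) (sgOf du)) he0 he1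
  · exact hπ2X_XA κ Φ t p D c mk (gT mk gx κ Φ t p D) (fT mk fx κ Φ t p D) P hP hN x du hd j hj z hlev1 hlev2 hEu (yLXFs κ Φ t p D c mk (gT mk gx κ Φ t p D) (fT mk fx κ Φ t p D) (sgOf du)) he0 hyl r hr
  · exact hπ3X_XA κ Φ t p D c mk (gT mk gx κ Φ t p D) (fT mk fx κ Φ t p D) P hP hN hκ hℓA x du hd j hj z hlev1 hlev2 hz hEu hkE (yLXFs κ Φ t p D c mk (gT mk gx κ Φ t p D) (fT mk fx κ Φ t p D) (sgOf du)) he0 he1 hyl r hr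

/-- **The x counts' ranges at the origin `yLXFs`** (per point; what the packager reads for the capped witnesses): `NrX + 1 ≤ 600·Kq` and
`N3X + 1 ≤ 240·Kq + 10` (N2: creep-aware tangential range). [folklore] -/
theorem rangesX_XFs (κ : Consts) {V : Type} [DecidableEq V] [Countable V] {G : SimpleGraph V} [G.LocallyFinite] (Φ : PlanarSkeletonFrmFrom G) (t : V) (p : unitInterval) (D : Skelφ.StepI.DataNS V) (c : ℕ) (mk : ℕ) (gx : Neg.FSlot) (fx : Neg.FSlot) (P : PCells2T) (hP : P.toPCells2 = fcellsA κ Φ t p D (gT mk gx κ Φ t p D) (fT mk fx κ Φ t p D))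
    (hN : EqNumL κ Φ t p D (gT mk gx κ Φ t p D) (fT mk fx κ Φ t p D)) (hκ : (hL κ Φ t p D (gT mk gx κ Φ t p D) (fT mk fx κ Φ t p D)).natAbs ≤ 10 * nL κ Φ t p D (gT mk gx κ Φ t p D) (fT mk fx κ Φ t p D))
    (hS : 16 * SF κ Φ t p D c mk ≤ ML κ Φ t p D (gT mk gx κ Φ t p D)) (hR0 : 22000 * (KS0.R'0 κ Φ t p D mk + 2) ≤ ML κ Φ t p D (gT mk gx κ Φ t p D))
    (x : Site 2) (du : MDir) (hd : du.1 = 0) (j : ℕ) (hj : j < P.K) (z : Site 2) {E : ℕ} {kE : ℤ}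
    (hlev1 : (P.faceL 0 j : ℤ) - E ≤ P.lev du x z) (hlev2 : P.lev du x z ≤ P.faceL 0 j + E)
    (hz : |z 1 - P.cenS x 1| ≤ kE) (hEu : (E : ℤ) ≤ u₀A κ Φ t p D (gT mk gx κ Φ t p D) (fT mk fx κ Φ t p D)) (hkE : kE ≤ 5 * (P.r 1 : ℤ)) :
    NrX κ Φ t p D (gT mk gx κ Φ t p D) (fT mk fx κ Φ t p D) P (yLXFs κ Φ t p D c mk (gT mk gx κ Φ t p D) (fT mk fx κ Φ t p D) (sgOf du)) (σTX κ Φ t p D (gT mk gx κ Φ t p D) (fT mk fx κ Φ t p D) P (yLXFs κ Φ t p D c mk (gT mk gx κ Φ t p D) (fT mk fx κ Φ t p D) (sgOf du)) x du z) x du z + 1 ≤ 600 * Neg.Kq κ ∧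
      N3X κ Φ t p D (gT mk gx κ Φ t p D) (fT mk fx κ Φ t p D) P (yLXFs κ Φ t p D c mk (gT mk gx κ Φ t p D) (fT mk fx κ Φ t p D) (sgOf du)) x du z + 1 ≤ 240 * Neg.Kq κ + 10 := by
  have hσ : sgOf du = 1 ∨ sgOf du = -1 := sgOf_sign du
  obtain ⟨hΛ₀, hΛ₁⟩ := Λ_yLXFs κ Φ t p D c mk (fT mk fx κ Φ t p D) gx hN hκ hS hR0 hσ
  have hσT : (σTX κ Φ t p D (gT mk gx κ Φ t p D) (fT mk fx κ Φ t p D) P (yLXFs κ Φ t p D c mk (gT mk gx κ Φ t p D) (fT mk fx κ Φ t p D) (sgOf du)) x du z) = 1 ∨ (σTX κ Φ t p D (gT mk gx κ Φ t p D) (fT mk fx κ Φ t p D) P (yLXFs κ Φ t p D c mk (gT mk gx κ Φ t p D) (fT mk fx κ Φ t p D) (sgOf du)) x du z) = -1 := by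
    unfold σTX; split_ifs <;> simp
  have he0 := he0_of_Λ₀ κ Φ t p D (gT mk gx κ Φ t p D) (fT mk fx κ Φ t p D) hN (yLXFs κ Φ t p D c mk (gT mk gx κ Φ t p D) (fT mk fx κ Φ t p D) (sgOf du)) hΛ₀ hσT
  have he1 := he1_of_Λ₁ κ Φ t p D (gT mk gx κ Φ t p D) (fT mk fx κ Φ t p D) hN (yLXFs κ Φ t p D c mk (gT mk gx κ Φ t p D) (fT mk fx κ Φ t p D) (sgOf du)) hΛ₁
  have hu0 : 1 ≤ u₀A κ Φ t p D (gT mk gx κ Φ t p D) (fT mk fx κ Φ t p D) := (units_eqA κ Φ t p D (gT mk gx κ Φ t p D) (fT mk fx κ Φ t p D)).2.2.2.2.1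
  have hu1 : 1 ≤ u₁A κ Φ t p D (gT mk gx κ Φ t p D) (fT mk fx κ Φ t p D) := (units_eqA κ Φ t p D (gT mk gx κ Φ t p D) (fT mk fx κ Φ t p D)).2.2.2.2.2
  exact ⟨(NrX_range κ Φ t p D (gT mk gx κ Φ t p D) (fT mk fx κ Φ t p D) P hP hN x du hd z hj hlev1 hlev2 (yLXFs κ Φ t p D c mk (gT mk gx κ Φ t p D) (fT mk fx κ Φ t p D) (sgOf du)) _ he0 (by linarith)).2,
    N3X_range κ Φ t p D (gT mk gx κ Φ t p D) (fT mk fx κ Φ t p D) P hP (yLXFs κ Φ t p D c mk (gT mk gx κ Φ t p D) (fT mk fx κ Φ t p D) (sgOf du)) x du hd z hz hkE he1 (by linarith)⟩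

end KS

end NegB

end PlanarSkeletonFrmFrom

end Summit.CriticalPhenomena.PercolationContinuityZ3.Theorems.Transplant

end
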